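import Summits.Ventures.Crystal3D.Theorems.StickyWulffConstantTextureBuildRiserBoxPartner
import HarnessLib

/-!
# The RISER PACKAGE (B6), part 10: SIBLING boxes; `BoxRow` for the riser input
# (lane T, crux `TextureLiminfV5`, stmt-Ventures-23912; design memo HOME/wulff-p2/g21/B6-DESIGN-g21.md §2; target `RiserPackage₇` of '…TextureBuildMeshV7')

HONEST FRAMING. Venture `Summits/Ventures/Crystal3D` (cell `crystal3d-full`), route `route-Ventures-StickyWulffConstant`, helper `--supports` the
law-v5 crux `TextureLiminfV5` (stmt-Ventures-23912).  Standard axioms; no mesh constructed; F-C1 not moved.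

* `boxRow_siblings` — a cell of box `r` against a cell of ANOTHER box `r'` (then a sibling of the same column pair, by `hBmatch₅`'s material list):
  the weight VANISHES (both columns complete ⇒ agreement; else the non-matching cell is claimed-vs-complete (impossible) or default-vs-complete
  (equal lattices or a horizontal datum, free by the shared axis of the columns));
* **`riserInput_boxRow`** — `BoxRow` HOLDS for the riser input `Mesh₅.riserInput` (rows RR '…RiserBoxCells', BX/XB '…RiserBoxPartner', siblings):
  the first conjunct of `RiserPackage₇`.
-/

noncomputable section

open scoped BigOperators InnerProductSpace

namespace Summit.Ventures.Crystal3D.Cruxes.TextureLiminf.TexShadow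

open Summit.Ventures.Crystal3D Summit.Ventures.Crystal3D.Theorems Set

namespace Mesh₅

variable {C R₀ : ℝ} {N : ℕ} {x : Fin N → E3} {rc : RiseredCover C R₀ N x} {δ : ℝ} (μ : Mesh₅ rc δ)
  (ct : (f : Fin rc.ng) → TentCert (rc.tent f)) (τ : Fin rc.nk → ℝ)

/-- Cells of different boxes: a cell of box `r'` is not inside box `r ≠ r'`. -/
theorem not_subset_of_subset_HB {r r' : Fin rc.nr} (hrr : r ≠ r') {i : Fin (μ.riserInput ct τ).cells.M}
    (hi : polytope ((μ.riserInput ct τ).cells.Hp i) ⊆ polytope (μ.HB r')) : ¬ polytope ((μ.riserInput ct τ).cells.Hp i) ⊆ polytope (μ.HB r) := by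
  intro h
  obtain ⟨z, hz⟩ := (μ.riserInput ct τ).cells.hne ((μ.riserInput ct τ).cells.idx i)
  exact Set.disjoint_left.1 (μ.hBB r r' hrr) (h hz) (hi hz)

/-- **One box's verdict**: a cell `i` of box `r` whose partner `i'` has a column grain of `r`, with `g' ∈ {rtL r, rtR r}` complete near the contact and
`grain i ≠ g'`: the weight vanishes (claimed-vs-complete is impossible; default-vs-complete is free). -/
theorem lawW_eq_zero_of_nonmatching {r : Fin rc.nr} {i i' : Fin (μ.riserInput ct τ).cells.M} (hne : i ≠ i')
    (hi : polytope ((μ.riserInput ct τ).cells.Hp i) ⊆ polytope (μ.HB r))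
    (hgi' : (μ.riserInput ct τ).grain i' = rc.rtL r ∨ (μ.riserInput ct τ).grain i' = rc.rtR r)
    (hg : (μ.riserInput ct τ).grain i' ≠ (μ.riserInput ct τ).grain i) {g' : Fin rc.ng} (hg'c : g' = rc.rtL r ∨ g' = rc.rtR r)
    (hgg : (μ.riserInput ct τ).grain i ≠ g') {y : E3} (hcomp : ∀ v ∈ rc.S g', dist y v ≤ 4 → v ∈ rc.X')
    {p : E3 × ℝ} (hp : p ∈ (μ.riserInput ct τ).cells.Hp i) (hy : y ∈ (μ.riserInput ct τ).contact i i' p) (hgen : (μ.riserInput ct τ).Generic p y) :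
    lawW (μ.riserInput ct τ).frameOf ((μ.riserInput ct τ).cells.cls i) ((μ.riserInput ct τ).cells.cls i') p.1 = 0 := by
  rcases hg'c with rfl | rfl
  · -- `f` complete, `i` default
    have hgi : (μ.riserInput ct τ).grain i = rc.rtR r := by
      rcases μ.grain_box_mem ct τ hi with h | h
      · exact absurd h hgg
      · exact h
    have hgi'f : (μ.riserInput ct τ).grain i' = rc.rtL r := by
      rcases hgi' with h | h
      · exact h
      · exact absurd (h.trans hgi.symm) hg
    rcases μ.cert_of_default_complete_rtL ct τ hne hi hgi hgi' hp hy hgen hcomp with hlat | hpm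
    · exact (μ.riserInput ct τ).lawW_eq_zero_of_lattice_eq hlat p.1
    · exact μ.lawW_columns_eq_zero_of_pm_rn' ct τ hgi hgi'f hpm
  · -- `g` complete, `i` claimed: impossible
    have hgi : (μ.riserInput ct τ).grain i = rc.rtL r := by
      rcases μ.grain_box_mem ct τ hi with h | h
      · exact h
      · exact absurd h hgg
    exact (μ.false_of_claimed_of_complete_rtR ct τ hi hgi hy.1.1 (fun v hv hd => hcomp v hv (by linarith))).elim

/-- The same verdict read from the partner's side (the box cell is the SECOND piece). -/
theorem lawW_eq_zero_of_nonmatching' {r : Fin rc.nr} {i i' : Fin (μ.riserInput ct τ).cells.M} (hne : i ≠ i')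
    (hi' : polytope ((μ.riserInput ct τ).cells.Hp i') ⊆ polytope (μ.HB r))
    (hgi : (μ.riserInput ct τ).grain i = rc.rtL r ∨ (μ.riserInput ct τ).grain i = rc.rtR r)
    (hg : (μ.riserInput ct τ).grain i' ≠ (μ.riserInput ct τ).grain i) {g' : Fin rc.ng} (hg'c : g' = rc.rtL r ∨ g' = rc.rtR r)
    (hgg : (μ.riserInput ct τ).grain i' ≠ g') {y : E3} (hcomp : ∀ v ∈ rc.S g', dist y v ≤ 4 → v ∈ rc.X')
    {p : E3 × ℝ} (hp : p ∈ (μ.riserInput ct τ).cells.Hp i) (hy : y ∈ (μ.riserInput ct τ).contact i i' p) (hgen : (μ.riserInput ct τ).Generic p y) :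
    lawW (μ.riserInput ct τ).frameOf ((μ.riserInput ct τ).cells.cls i) ((μ.riserInput ct τ).cells.cls i') p.1 = 0 := by
  have hp' : antip p ∈ (μ.riserInput ct τ).cells.Hp i' := (μ.riserInput ct τ).antip_mem_Hp_of_contact hne hp hy hgen
  have hy' : y ∈ (μ.riserInput ct τ).contact i' i (antip p) := (μ.riserInput ct τ).contact_symm hy
  have hgen' : (μ.riserInput ct τ).Generic (antip p) y := (μ.riserInput ct τ).generic_antip hgen
  rcases hg'c with rfl | rfl
  · -- `f` complete, `i'` default
    have hgi' : (μ.riserInput ct τ).grain i' = rc.rtR r := by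
      rcases μ.grain_box_mem ct τ hi' with h | h
      · exact absurd h hgg
      · exact h
    have hgif : (μ.riserInput ct τ).grain i = rc.rtL r := by
      rcases hgi with h | h
      · exact h
      · exact absurd (hgi'.trans h.symm) hg
    rcases μ.cert_of_default_complete_rtL ct τ hne.symm hi' hgi' hgi hp' hy' hgen' hcomp with hlat | hpm
    · exact (μ.riserInput ct τ).lawW_eq_zero_of_lattice_eq hlat.symm p.1
    · refine μ.lawW_columns_eq_zero_of_pm_rn ct τ hgif hgi' ?_
      simp only [antip] at hpm
      rcases hpm with h | h
      · right; rw [← h, neg_neg]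
      · left; exact neg_injective h
  · -- `g` complete, `i'` claimed: impossible
    have hgi' : (μ.riserInput ct τ).grain i' = rc.rtL r := by
      rcases μ.grain_box_mem ct τ hi' with h | h
      · exact h
      · exact absurd h hgg
    exact (μ.false_of_claimed_of_complete_rtR ct τ hi' hgi' hy.2 (fun v hv hd => hcomp v hv (by linarith))).elim

/-- **SIBLING BOXES**: a cell of box `r` against a cell of another box, different grains, generic non-designated contact: the weight VANISHES. -/
theorem boxRow_siblings (hτ : ∀ k, τ k ∈ Set.Ioo (0 : ℝ) 1) {r r' : Fin rc.nr} (hrr : r ≠ r') {i i' : Fin (μ.riserInput ct τ).cells.M}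
    (hi : polytope ((μ.riserInput ct τ).cells.Hp i) ⊆ polytope (μ.HB r)) (hi' : polytope ((μ.riserInput ct τ).cells.Hp i') ⊆ polytope (μ.HB r'))
    (hg : (μ.riserInput ct τ).grain i' ≠ (μ.riserInput ct τ).grain i) {p : E3 × ℝ} (hp : p ∈ (μ.riserInput ct τ).cells.Hp i) {y : E3}
    (hy : y ∈ (μ.riserInput ct τ).contact i i' p) (hgen : (μ.riserInput ct τ).Generic p y) (hnd : y ∉ μ.desOf₂ p) :
    lawW (μ.riserInput ct τ).frameOf ((μ.riserInput ct τ).cells.cls i) ((μ.riserInput ct τ).cells.cls i') p.1 = 0 := by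
  have hne : i ≠ i' := fun e => hg (by rw [e])
  have hi'r := μ.not_subset_of_subset_HB ct τ hrr hi'
  have hir' := μ.not_subset_of_subset_HB ct τ (Ne.symm hrr) hi
  -- the match from box `r`
  obtain ⟨g₁, hg₁c, hcomp₁, hmat₁⟩ := μ.box_partner ct τ hτ hne hi hi'r hp hy hgen hnd
  have hpair : rc.rtL r' = rc.rtL r ∧ rc.rtR r' = rc.rtR r ∨ rc.rtL r' = rc.rtR r ∧ rc.rtR r' = rc.rtL r := by
    rcases hmat₁ with ⟨-, hnb⟩ | ⟨r'', -, hpair'', hsub⟩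
    · exact absurd hi' (hnb r')
    · have : r'' = r' := by
        by_contra hne''
        exact μ.not_subset_of_subset_HB ct τ hne'' hi' hsub
      subst this
      exact hpair''
  -- the match from box `r'`
  have hp' : antip p ∈ (μ.riserInput ct τ).cells.Hp i' := (μ.riserInput ct τ).antip_mem_Hp_of_contact hne hp hy hgen
  have hnd' : y ∉ μ.desOf₂ (antip p) := by rw [μ.desOf₂_antip]; exact hnd
  obtain ⟨g₂, hg₂c, hcomp₂, -⟩ := μ.box_partner ct τ hτ hne.symm hi' hir' hp' ((μ.riserInput ct τ).contact_symm hy) ((μ.riserInput ct τ).generic_antip hgen) hnd'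
  -- grains of the two cells, as column grains of `r` and of `r'`
  have hgi : (μ.riserInput ct τ).grain i = rc.rtL r ∨ (μ.riserInput ct τ).grain i = rc.rtR r := μ.grain_box_mem ct τ hi
  have hgi'r' : (μ.riserInput ct τ).grain i' = rc.rtL r' ∨ (μ.riserInput ct τ).grain i' = rc.rtR r' := μ.grain_box_mem ct τ hi'
  have hgi' : (μ.riserInput ct τ).grain i' = rc.rtL r ∨ (μ.riserInput ct τ).grain i' = rc.rtR r := by
    rcases hpair with ⟨e1, e2⟩ | ⟨e1, e2⟩ <;> rcases hgi'r' with h | h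
    · exact Or.inl (h.trans e1)
    · exact Or.inr (h.trans e2)
    · exact Or.inr (h.trans e1)
    · exact Or.inl (h.trans e2)
  have hgir' : (μ.riserInput ct τ).grain i = rc.rtL r' ∨ (μ.riserInput ct τ).grain i = rc.rtR r' := by
    rcases hpair with ⟨e1, e2⟩ | ⟨e1, e2⟩ <;> rcases hgi with h | h
    · exact Or.inl (h.trans e1.symm)
    · exact Or.inr (h.trans e2.symm)
    · exact Or.inr (h.trans e2.symm)
    · exact Or.inl (h.trans e1.symm)
  have hg₂c' : g₂ = rc.rtL r ∨ g₂ = rc.rtR r := by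
    rcases hpair with ⟨e1, e2⟩ | ⟨e1, e2⟩ <;> rcases hg₂c with h | h
    · exact Or.inl (h.trans e1)
    · exact Or.inr (h.trans e2)
    · exact Or.inr (h.trans e1)
    · exact Or.inl (h.trans e2)
  by_cases h12 : g₁ = g₂
  · -- one complete grain `G`; the non-matching cell decides
    subst h12
    by_cases hgg : (μ.riserInput ct τ).grain i = g₁
    · -- `i'` is the non-matching cell, in box `r'`
      have hgg' : (μ.riserInput ct τ).grain i' ≠ g₁ := fun h => hg (h.trans hgg.symm)
      exact μ.lawW_eq_zero_of_nonmatching' ct τ hne hi' hgir' hg hg₂c hgg' hcomp₁ hp hy hgen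
    · exact μ.lawW_eq_zero_of_nonmatching ct τ hne hi hgi' hg hg₁c hgg hcomp₁ hp hy hgen
  · -- both columns complete: agreement
    have hcf : ∀ v ∈ rc.S (rc.rtL r), dist y v ≤ 4 → v ∈ rc.X' := by
      rcases hg₁c with e | e
      · rw [← e]; exact hcomp₁
      · rcases hg₂c' with e' | e'
        · rw [← e']; exact hcomp₂
        · exact absurd (e.trans e'.symm) h12
    have hcg : ∀ v ∈ rc.S (rc.rtR r), dist y v ≤ 4 → v ∈ rc.X' := by
      rcases hg₁c with e | e
      · rcases hg₂c' with e' | e'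
        · exact absurd (e.trans e'.symm) h12
        · rw [← e']; exact hcomp₂
      · rw [← e]; exact hcomp₁
    exact μ.lawW_eq_zero_of_both_complete ct τ hgi hgi' hg hy hgen hcf hcg

/-! ### `BoxRow` for the riser input -/

/-- **`BoxRow` HOLDS FOR THE RISER INPUT** (first conjunct of `RiserPackage₇`): every cross-grain contact involving a riser-box cell, at a generic
non-designated point, is a CURTAIN special (a wall of a hexagon prism inside one box) or FREE. -/
theorem riserInput_boxRow (hτ : ∀ k, τ k ∈ Set.Ioo (0 : ℝ) 1) : (μ.riserInput ct τ).BoxRow := by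
  intro i i' hg hbox p hp y hy hgen hnd
  rcases hbox with ⟨r, hi⟩ | ⟨r, hi'⟩
  · by_cases hi'r : polytope ((μ.riserInput ct τ).cells.Hp i') ⊆ polytope (μ.HB r)
    · exact μ.boxRow_same_box ct τ hi hi'r hg hp hy hgen
    · by_cases hob : ∃ r', polytope ((μ.riserInput ct τ).cells.Hp i') ⊆ polytope (μ.HB r')
      · obtain ⟨r', hi'⟩ := hob
        have hrr : r ≠ r' := fun e => hi'r (by rw [e]; exact hi')
        exact Or.inr (μ.boxRow_siblings ct τ hτ hrr hi hi' hg hp hy hgen hnd)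
      · exact Or.inr (μ.boxRow_out ct τ hτ hi (fun r'' h => hob ⟨r'', h⟩) hg hp hy hgen hnd)
  · by_cases hir : polytope ((μ.riserInput ct τ).cells.Hp i) ⊆ polytope (μ.HB r)
    · exact μ.boxRow_same_box ct τ hir hi' hg hp hy hgen
    · by_cases hob : ∃ r', polytope ((μ.riserInput ct τ).cells.Hp i) ⊆ polytope (μ.HB r')
      · obtain ⟨r', hi⟩ := hob
        have hrr : r' ≠ r := fun e => hir (by rw [← e]; exact hi)
        exact Or.inr (μ.boxRow_siblings ct τ hτ hrr hi hi' hg hp hy hgen hnd)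
      · exact Or.inr (μ.boxRow_in ct τ hτ (fun r'' h => hob ⟨r'', h⟩) hi' hg hp hy hgen hnd)

end Mesh₅

end Summit.Ventures.Crystal3D.Cruxes.TextureLiminf.TexShadow

end
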